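import Literature.MathematicalPhysics.QuantumFieldTheory.BalabanImbrieJaffe1984to88.BIJ88Sect2Statements
import Literature.Probability.LatticeModels.PolymerGasGeometric
import Literature.MathematicalPhysics.QuantumFieldTheory.BalabanImbrieJaffe1984to88.BIJ88WalkGeometryZd

/-!
# `BalabanImbrieJaffe1984to88.BIJ88Close247Animals` — T. Bałaban, J. Imbrie, A. Jaffe, *Effective action and cluster properties of
the abelian Higgs model*, Commun. Math. Phys. **114** (1988) 257–315 [BalabanImbrieJaffe1988]: the PRINTED route to **(2.47)**, p. 265 —
*"This estimate [(2.46)] can be summed over all connected sets X to show that (2.47)"* — PROVED as the hence-step (2.45) + (2.46) ⟹ (2.47)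
over r18's abstract real kernels, the summation over connected unions `X` of `r(e_k)`-cubes controlled by the tree's lattice-animal bound
`Literature.Probability.LatticeModels.sum_pow_card_le_of_connected` [FriedliVelenik2017, Lemma 3.38]

statement-level skeleton of published theorems with citation tags; proofs where landed; nothing here is a claim about the Yang–Mills mass gap

PDF held: `paper:balaban1988-cmp114-bij-abelian-higgs-effective-action` (journal page = PDF page + 256); pp. 264–265 [PDF 8–9] read this
session from the text layer (`lit read … --pages 8-9`).

WHAT IS REPRODUCED.  SKELETON row **C2.Eq2.47** along the route the paper prints (cell `lit-balaban`, HOME `run/shared/lean/pub/lit-balaban/`;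
Phase-2 seat p02 gen 3 = unit `lit-balaban-p02`; C2 §§1–4 fold owner r18, referee ref-5; TAKING line HOME/STATUS.md 2026-08-21T04:51:11Z).
The row's proof of record is p36's `BIJ88Ineq247Walks.close247` («model instance» in the setting of [6]), whose docstring says verbatim *"the
route does not need the sum over X of (2.45)/(2.46)"*: it resums the non-primed WALKS directly.  The present file supplies the other, printed,
mechanism, so that the typed rows **C2.Eq2.45** (`BIJ88Sect2Statements.Eq245`) and **C2.Eq2.46** (`BIJ88Sect2Statements.Ineq246`) — and by the
last sentence of Sect. 2 the gauge-field analogue **(2.49)** *"with similar estimates"* — enter a PROVED implication as its hypotheses.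
pp. 264–265, verbatim: *"Then we define C^{(k)}_Λ(u) = C^{(k)}_{Λ,loc}(u) + Σ_X C^{(k)}_{Λ,X}(u), (2.45) where C^{(k)}_{Λ,X}(u) = Σ^X_ω C^{(k)}_{Λ,ω}(u)
and Σ^X_ω denotes the sum over all ω not in Σ′_ω such that … = X. We take X to be an arbitrary connected union of r(e_k) lattice cubes …
The operator C^{(k)}_{Λ,X}(u) depends only on u in X. It vanishes unless both arguments are in X, and is estimated as follows:
|C^{(k)}_{Λ,X}(u;x₁,x₂)| ≦ e^{−cr(e_k)|X|}. (2.46) Here and elsewhere, |X| refers to the number of r(e_k)-cubes in X, not the volume of X. This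
estimate can be summed over all connected sets X to show that |C^{(k)}_{Λ,loc}(u;x₁,x₂) − C^{(k)}_Λ(u;x₁,x₂)| ≦ e^{−cr(e_k)}e^{−c|x₁−x₂|}. (2.47)"*

WHAT IS PROVED HERE (0 `sorry`, standard axioms; theorems only).  Sites `x : α` lie in `r(e_k)`-cubes `cubeOf x : V` (`V` finite: the cubes
of `T^{(k)}_η`); the sets `X` are `Finset V` (r18's `ξ`, `|X| = X.card`, `mem x X ↔ cubeOf x ∈ X`, exactly as in p36's instances
`BIJ88Ineq246Walks.ineq246` / `BIJ88Ineq247Walks.ineq246_Zd`); cube adjacency `R` (symmetric, `≤ Δ` neighbours listed by `nbr`); the printed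
*"connected union"* is `Literature.Probability.LatticeModels.IsRConnected R X`, and (2.44)'s «C_X is only defined/non-zero for connected X»
is the hypothesis `hconn`.
§1 `abs_sub_le_sum_abs` — (2.45) gives `|C_loc − C| ≤ Σ_X |C_X|`.
§2 `diam_le_of_isRConnected` — in an `R`-connected `X`, two cubes are joined by an `R`-path inside `X` of at most `|X| − 1` steps (Mathlib's
`SimpleGraph.Walk.IsPath.length_lt` on the graph `SimpleGraph.fromRel` induced on `X`), so a cube pseudo-distance with steps `≤ ℓ` is
`≤ ℓ(|X| − 1)` on `X`; `dist_le_of_isRConnected` — hence sites of two cubes of a connected `X` are within `ℓ|X|` when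
`dist x₁ x₂ ≤ cd(cubeOf x₁, cubeOf x₂) + ℓ`: the geometric input «|x₁ − x₂| ≲ r(e_k)|X|» of the summation.
§3 **(2.47), two explicit constants**: `close247_of_ineq246` — from (2.45), (2.46) with constants `(c, r(e_k))`, `hconn`, the site-diameter
bound `dist x₁ x₂ ≤ κ|X|` on connected `X ∋ cubeOf x₁, cubeOf x₂`, and «r(e_k) large» `(Δ + 1)² e^{−(c/2)r(e_k)} ≤ ½`:
`|C_loc(x₁,x₂) − C(x₁,x₂)| ≤ 2e^{−(c/2)r(e_k)} · e^{−(c·r(e_k)/(2κ))|x₁−x₂|}` (split `e^{−cr|X|} = e^{−(c/2)r|X|}·λ^{|X|}`, `λ = e^{−(c/2)r}`; the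
first factor is `≤ e^{−(c·r/(2κ))|x₁−x₂|}`, the animal sum of the second through `cubeOf x₁` is `≤ 2λ` by the tree's
`sum_pow_card_le_of_connected`).
§4 **THE TYPED ROW**: `close247_typed` — r18's one-letter `BIJ88Sect2Statements.Close dist C_loc C (e^{−c′r(e_k)}) c′` under the compatibility
`c′ ≤ c·r(e_k)/(2κ)`, `2e^{−(c/2)r(e_k)} ≤ e^{−c′r(e_k)}` (prefactor vs rate: HOME/GAPS.md G-C2-p02-02), `0 ≤ dist`.
§5 **MODEL INSTANCE OF THE GEOMETRY ON `ℤ^d`**: `close247_of_ineq246_Zd` — points placed in `ℤ^d`, p36's cubes `BIJ88WalkGeometryZd.Cube pos ℓ`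
/ `cubeOf`, touching `B4RandomWalk213.cubeAdj` (degree `≤ 3^d`), `supDist`; every geometric hypothesis discharged (`κ = ℓ`, via
`natAbs_sub_le_of_cubeIdx` / `supDist_le_of_cubeIdx`: points are within `ℓ·supDist(cube indices) + ℓ`), leaving (2.45), (2.46), the
connectedness clause and `(3^d + 1)²e^{−(c/2)r(e_k)} ≤ ½`.
HONEST SCOPE.  (2.45) and (2.46) are INPUTS here (statement rows; (2.46) is proved in [6]'s setting by p36's `BIJ88Ineq246Walks.ineq246`, and
the regions of nearest-neighbour walks are connected by p13's `BIJ88RandomWalk242`); this file is the summation step only, for an abstract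
site/cube geometry whose two parameters (`Δ`, `κ`) are explicit, instantiated on `ℤ^d` with points = labels of the `M`-lattice (p36's
dictionary p. 264; unit-lattice sites at `M′` per label unit only rescale `dist`, not done here); nothing on d = 4 or the continuum; NOT summit
progress.
-/

namespace Literature.MathematicalPhysics.QuantumFieldTheory.BalabanImbrieJaffe1984to88.BIJ88Close247Animals

open Finset BIJ88Sect2Statements Literature.Probability.LatticeModels

noncomputable section

variable {α V : Type*}

/-! ## §1  (2.45): the difference is the sum over `X` -/

/-- From **(2.45)** `C = C_loc + Σ_X C_X`: `|C_loc(x₁,x₂) − C(x₁,x₂)| ≤ Σ_X |C_X(x₁,x₂)|`. [cite: BalabanImbrieJaffe1988, (2.45) p.264] -/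
theorem abs_sub_le_sum_abs {ξ : Type*} [Fintype ξ] {C Cloc : α → α → ℝ} {CX : ξ → α → α → ℝ} (h245 : Eq245 C Cloc CX)
    (x₁ x₂ : α) : |Cloc x₁ x₂ - C x₁ x₂| ≤ ∑ X, |CX X x₁ x₂| := by
  rw [h245 x₁ x₂, show Cloc x₁ x₂ - (Cloc x₁ x₂ + ∑ X, CX X x₁ x₂) = -∑ X, CX X x₁ x₂ by ring, abs_neg]
  exact abs_sum_le_sum_abs _ _

/-! ## §2  Connected unions of cubes have diameter at most `ℓ(|X| − 1)` -/

section Diam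

variable {R : V → V → Prop}

/-- An `R`-chain inside `X` is a walk of the graph induced on `X` by the symmetrised adjacency (Mathlib's `SimpleGraph.fromRel`,
loops removed). [folklore] -/
private theorem reachable_induced_of_reflTransGen {X : Finset V} {v w : V} (hv : v ∈ X) (hw : w ∈ X)
    (h : Relation.ReflTransGen (fun x y => R x y ∧ x ∈ X ∧ y ∈ X) v w) :
    (SimpleGraph.fromRel fun a b : X => R a.1 b.1).Reachable ⟨v, hv⟩ ⟨w, hw⟩ := by
  induction h with
  | refl => exact SimpleGraph.Reachable.refl _
  | @tail b c _ hbc ih =>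
    obtain ⟨hR, hb, hc⟩ := hbc
    by_cases hbc' : b = c
    · subst hbc'; exact ih hb
    · refine (ih hb).trans (SimpleGraph.Adj.reachable ?_)
      rw [SimpleGraph.fromRel_adj]
      exact ⟨fun h => hbc' (congrArg Subtype.val h), Or.inl hR⟩

/-- Along a walk of the induced graph a pseudo-distance with `R`-steps `≤ ℓ` grows at most by `ℓ` per step. [folklore] -/
private theorem cd_le_mul_length {X : Finset V} (cd : V → V → ℝ) (hcd0 : ∀ v, cd v v ≤ 0)
    (htri : ∀ u v w, cd u w ≤ cd u v + cd v w) {ℓ : ℝ} (hstep : ∀ v w, R v w → cd v w ≤ ℓ ∧ cd w v ≤ ℓ)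
    {a b : X} (p : (SimpleGraph.fromRel fun a b : X => R a.1 b.1).Walk a b) : cd a.1 b.1 ≤ ℓ * p.length := by
  induction p with
  | nil => simpa using hcd0 _
  | @cons u v w hadj p ih =>
    have huv : cd u.1 v.1 ≤ ℓ := by
      rcases (SimpleGraph.fromRel_adj _ _ _).1 hadj with ⟨-, h | h⟩
      · exact (hstep _ _ h).1
      · exact (hstep _ _ h).2
    calc cd u.1 w.1 ≤ cd u.1 v.1 + cd v.1 w.1 := htri _ _ _
      _ ≤ ℓ + ℓ * p.length := add_le_add huv ih
      _ = ℓ * (SimpleGraph.Walk.cons hadj p).length := by rw [SimpleGraph.Walk.length_cons]; push_cast; ring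

/-- **Diameter of a connected union of cubes.** If `X` is `R`-connected (`IsRConnected R X`) and `cd` is a pseudo-distance on cubes
(`cd v v ≤ 0`, triangle inequality) with `cd ≤ ℓ` across `R`-adjacent cubes (`0 ≤ ℓ`), then any two cubes of `X` satisfy
`cd v w ≤ ℓ(|X| − 1)`: join them by an `R`-path inside `X` without repeated cubes (`SimpleGraph.Walk.toPath`), which has at most `|X| − 1`
steps (`SimpleGraph.Walk.IsPath.length_lt`) — the geometry of (2.44)'s *"arbitrary connected union of r(e_k) lattice cubes"* behind the
summation of (2.46) on p. 265. [cite: BalabanImbrieJaffe1988, (2.44) p.264] -/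
theorem diam_le_of_isRConnected {X : Finset V} (hX : IsRConnected R X) (cd : V → V → ℝ) (hcd0 : ∀ v, cd v v ≤ 0)
    (htri : ∀ u v w, cd u w ≤ cd u v + cd v w) {ℓ : ℝ} (hℓ : 0 ≤ ℓ) (hstep : ∀ v w, R v w → cd v w ≤ ℓ ∧ cd w v ≤ ℓ)
    {v w : V} (hv : v ∈ X) (hw : w ∈ X) : cd v w ≤ ℓ * (X.card - 1 : ℝ) := by
  classical
  obtain ⟨p⟩ := reachable_induced_of_reflTransGen hv hw (hX.2 v hv w hw)
  set q := p.toPath with hq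
  have hlen : (q.1.length : ℝ) ≤ X.card - 1 := by
    have h1 : q.1.length < Fintype.card X := q.2.length_lt
    have h2 : Fintype.card X = X.card := Fintype.card_coe X
    have h3 : (q.1.length : ℝ) + 1 ≤ X.card := by exact_mod_cast (by omega : q.1.length + 1 ≤ X.card)
    linarith
  calc cd v w ≤ ℓ * q.1.length := cd_le_mul_length cd hcd0 htri hstep q.1
    _ ≤ ℓ * (X.card - 1 : ℝ) := mul_le_mul_of_nonneg_left hlen hℓ

/-- **Sites of a connected union of cubes are within `ℓ|X|`.** With `cd`, `ℓ` as in `diam_le_of_isRConnected` and sites dominated through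
their cubes, `dist x₁ x₂ ≤ cd(cubeOf x₁, cubeOf x₂) + ℓ` (two half-cubes), two sites whose cubes lie in an `R`-connected `X` satisfy
`dist x₁ x₂ ≤ ℓ·|X|` — the geometric input «|x₁ − x₂| ≲ r(e_k)|X|» of the summation of (2.46) over connected sets on p. 265.
[cite: BalabanImbrieJaffe1988, (2.44) p.264] -/
theorem dist_le_of_isRConnected {X : Finset V} (hX : IsRConnected R X) (cd : V → V → ℝ) (hcd0 : ∀ v, cd v v ≤ 0)
    (htri : ∀ u v w, cd u w ≤ cd u v + cd v w) {ℓ : ℝ} (hℓ : 0 ≤ ℓ) (hstep : ∀ v w, R v w → cd v w ≤ ℓ ∧ cd w v ≤ ℓ)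
    (cubeOf : α → V) (dist : α → α → ℝ) (hdom : ∀ x₁ x₂, dist x₁ x₂ ≤ cd (cubeOf x₁) (cubeOf x₂) + ℓ)
    {x₁ x₂ : α} (h₁ : cubeOf x₁ ∈ X) (h₂ : cubeOf x₂ ∈ X) : dist x₁ x₂ ≤ ℓ * X.card := by
  have h := diam_le_of_isRConnected hX cd hcd0 htri hℓ hstep h₁ h₂
  calc dist x₁ x₂ ≤ cd (cubeOf x₁) (cubeOf x₂) + ℓ := hdom x₁ x₂
    _ ≤ ℓ * (X.card - 1 : ℝ) + ℓ := by linarith [h]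
    _ = ℓ * X.card := by ring

end Diam

/-! ## §3  (2.46) summed over all connected sets `X`: (2.47) with two explicit constants -/

section Sum

variable [Fintype V] [DecidableEq V] {R : V → V → Prop} {nbr : V → Finset V} {Δ : ℕ}

/-- **The animal summation of p. 265.** If `C_X(x₁,x₂) ≠ 0` only for `R`-connected `X` containing the cubes of `x₁` and `x₂` ((2.44),
first clause of (2.46)), `|C_X(x₁,x₂)| ≤ e^{−c·r(e_k)·|X|}` (second clause of (2.46), `0 ≤ c`, `0 ≤ r(e_k)`), sites of a connected `X` are
within `κ|X|` (`0 < κ`, cf. `dist_le_of_isRConnected`), cubes have `≤ Δ` `R`-neighbours and `r(e_k)` is large, `(Δ + 1)²e^{−(c/2)r(e_k)} ≤ ½`,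
then `Σ_X |C_X(x₁,x₂)| ≤ 2e^{−(c/2)r(e_k)} e^{−(c·r(e_k)/(2κ)) dist(x₁,x₂)}`. [cite: BalabanImbrieJaffe1988, (2.46)–(2.47) pp.264–265] -/
theorem sum_abs_le (hR : ∀ v w, R v w → R w v) (hΔ : ∀ v, (nbr v).card ≤ Δ) (hnbr : ∀ v w, R v w → w ∈ nbr v)
    (cubeOf : α → V) (dist : α → α → ℝ) (CX : Finset V → α → α → ℝ) {c rek κ : ℝ} (hc : 0 ≤ c) (hrek : 0 ≤ rek) (hκ : 0 < κ)
    (hconn : ∀ X x₁ x₂, CX X x₁ x₂ ≠ 0 → IsRConnected R X ∧ cubeOf x₁ ∈ X ∧ cubeOf x₂ ∈ X)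
    (hbound : ∀ X x₁ x₂, |CX X x₁ x₂| ≤ Real.exp (-c * rek * X.card))
    (hdiam : ∀ X x₁ x₂, IsRConnected R X → cubeOf x₁ ∈ X → cubeOf x₂ ∈ X → dist x₁ x₂ ≤ κ * X.card)
    (hlarge : ((Δ : ℝ) + 1) ^ 2 * Real.exp (-(c / 2) * rek) ≤ 1 / 2) (x₁ x₂ : α) :
    ∑ X, |CX X x₁ x₂| ≤ 2 * Real.exp (-(c / 2) * rek) * Real.exp (-(c * rek / (2 * κ)) * dist x₁ x₂) := by
  classical
  set lam : ℝ := Real.exp (-(c / 2) * rek) with hlam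
  set 𝒴 : Finset (Finset V) := univ.filter fun X => CX X x₁ x₂ ≠ 0 with h𝒴
  -- only the contributing `X` matter
  have hsplit : ∑ X, |CX X x₁ x₂| = ∑ X ∈ 𝒴, |CX X x₁ x₂| := by
    rw [h𝒴, sum_filter]
    refine sum_congr rfl fun X _ => ?_
    split_ifs with h
    · rfl
    · rw [not_not.1 h, abs_zero]
  -- each contributing term: `e^{−cr|X|} = e^{−(c/2)r|X|}·λ^{|X|} ≤ e^{−(cr/(2κ))dist}·λ^{|X|}`
  have hterm : ∀ X ∈ 𝒴, |CX X x₁ x₂| ≤ Real.exp (-(c * rek / (2 * κ)) * dist x₁ x₂) * lam ^ X.card := by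
    intro X hX
    obtain ⟨hXc, h1, h2⟩ := hconn X x₁ x₂ (mem_filter.1 hX).2
    have hd := hdiam X x₁ x₂ hXc h1 h2
    have hexp : Real.exp (-c * rek * X.card) = Real.exp (-(c / 2) * rek * X.card) * lam ^ X.card := by
      rw [hlam, ← Real.exp_nat_mul, ← Real.exp_add]
      congr 1; ring
    have hmono : Real.exp (-(c / 2) * rek * X.card) ≤ Real.exp (-(c * rek / (2 * κ)) * dist x₁ x₂) := by
      refine Real.exp_le_exp.2 ?_
      have : c * rek / (2 * κ) * dist x₁ x₂ ≤ c * rek / (2 * κ) * (κ * X.card) := mul_le_mul_of_nonneg_left hd (by positivity)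
      have hκ' : c * rek / (2 * κ) * (κ * X.card) = c / 2 * rek * X.card := by field_simp
      linarith
    calc |CX X x₁ x₂| ≤ Real.exp (-c * rek * X.card) := hbound X x₁ x₂
      _ = Real.exp (-(c / 2) * rek * X.card) * lam ^ X.card := hexp
      _ ≤ Real.exp (-(c * rek / (2 * κ)) * dist x₁ x₂) * lam ^ X.card :=
          mul_le_mul_of_nonneg_right hmono (pow_nonneg (Real.exp_nonneg _) _)
  -- the lattice-animal sum through the cube of `x₁`
  have hanimal : ∑ X ∈ 𝒴, lam ^ X.card ≤ 2 * lam :=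
    sum_pow_card_le_of_connected hR hΔ hnbr (Real.exp_nonneg _) hlarge (cubeOf x₁) 𝒴 fun X hX =>
      let h := hconn X x₁ x₂ (mem_filter.1 hX).2
      ⟨h.2.1, h.1⟩
  calc ∑ X, |CX X x₁ x₂| = ∑ X ∈ 𝒴, |CX X x₁ x₂| := hsplit
    _ ≤ ∑ X ∈ 𝒴, Real.exp (-(c * rek / (2 * κ)) * dist x₁ x₂) * lam ^ X.card := sum_le_sum hterm
    _ = Real.exp (-(c * rek / (2 * κ)) * dist x₁ x₂) * ∑ X ∈ 𝒴, lam ^ X.card := by rw [mul_sum]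
    _ ≤ Real.exp (-(c * rek / (2 * κ)) * dist x₁ x₂) * (2 * lam) := mul_le_mul_of_nonneg_left hanimal (Real.exp_nonneg _)
    _ = 2 * Real.exp (-(c / 2) * rek) * Real.exp (-(c * rek / (2 * κ)) * dist x₁ x₂) := by rw [hlam]; ring

/-- **(2.47) BY THE PRINTED ROUTE, two explicit constants**, p. 265 [PDF 9], verbatim: *"This estimate can be summed over all connected
sets X to show that |C^{(k)}_{Λ,loc}(u;x₁,x₂) − C^{(k)}_Λ(u;x₁,x₂)| ≦ e^{−cr(e_k)}e^{−c|x₁−x₂|}. (2.47)"* — from **(2.45)** (r18's `Eq245`, the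
sets `X` ranging over `Finset V`, `C_X := 0` off the connected unions), **(2.46)** (r18's `Ineq246` with `|X| = X.card`, `mem x X ↔ cubeOf x ∈ X`,
constants `c ≥ 0`, `r(e_k) ≥ 0`), the connectedness clause of (2.44) (`hconn`), the site-diameter bound `κ|X|` of connected unions (`hdiam`;
PROVED for cube geometries by `dist_le_of_isRConnected`, on `ℤ^d` in §5), `≤ Δ` neighbouring cubes, and «r(e_k) large»
`(Δ + 1)²e^{−(c/2)r(e_k)} ≤ ½`: `|C_loc(x₁,x₂) − C(x₁,x₂)| ≤ 2e^{−(c/2)r(e_k)} · e^{−(c·r(e_k)/(2κ))dist(x₁,x₂)}`.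
[cite: BalabanImbrieJaffe1988, (2.47) p.265] -/
theorem close247_of_ineq246 (hR : ∀ v w, R v w → R w v) (hΔ : ∀ v, (nbr v).card ≤ Δ) (hnbr : ∀ v w, R v w → w ∈ nbr v)
    (cubeOf : α → V) (dist : α → α → ℝ) {C Cloc : α → α → ℝ} {CX : Finset V → α → α → ℝ} {c rek κ : ℝ} (hc : 0 ≤ c)
    (hrek : 0 ≤ rek) (hκ : 0 < κ) (h245 : Eq245 C Cloc CX)
    (h246 : Ineq246 (fun X : Finset V => X.card) (fun x X => cubeOf x ∈ X) CX c rek)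
    (hconn : ∀ X x₁ x₂, CX X x₁ x₂ ≠ 0 → IsRConnected R X)
    (hdiam : ∀ X x₁ x₂, IsRConnected R X → cubeOf x₁ ∈ X → cubeOf x₂ ∈ X → dist x₁ x₂ ≤ κ * X.card)
    (hlarge : ((Δ : ℝ) + 1) ^ 2 * Real.exp (-(c / 2) * rek) ≤ 1 / 2) (x₁ x₂ : α) :
    |Cloc x₁ x₂ - C x₁ x₂| ≤ 2 * Real.exp (-(c / 2) * rek) * Real.exp (-(c * rek / (2 * κ)) * dist x₁ x₂) := by
  refine (abs_sub_le_sum_abs h245 x₁ x₂).trans (sum_abs_le hR hΔ hnbr cubeOf dist CX hc hrek hκ ?_ ?_ hdiam hlarge x₁ x₂)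
  · intro X y₁ y₂ hne
    have hmem : cubeOf y₁ ∈ X ∧ cubeOf y₂ ∈ X := by
      by_contra h
      exact hne (h246.1 X y₁ y₂ h)
    exact ⟨hconn X y₁ y₂ hne, hmem.1, hmem.2⟩
  · intro X y₁ y₂
    simpa [mul_assoc] using h246.2 X y₁ y₂

end Sum

/-! ## §4  The typed row (2.47) -/

section Typed

variable [Fintype V] [DecidableEq V] {R : V → V → Prop} {nbr : V → Finset V} {Δ : ℕ}

/-- **THE TYPED ROW (2.47)** `BIJ88Sect2Statements.Close dist C_loc C (e^{−c′r(e_k)}) c′` by the printed route, under the hypotheses of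
`close247_of_ineq246`, `0 ≤ dist`, and the compatibility of the one-letter constant `c′` with the two derived ones: `c′ ≤ c·r(e_k)/(2κ)` and
`2e^{−(c/2)r(e_k)} ≤ e^{−c′r(e_k)}` («r(e_k) large»; prefactor vs rate, HOME/GAPS.md G-C2-p02-02). [cite: BalabanImbrieJaffe1988, (2.47) p.265] -/
theorem close247_typed (hR : ∀ v w, R v w → R w v) (hΔ : ∀ v, (nbr v).card ≤ Δ) (hnbr : ∀ v w, R v w → w ∈ nbr v)
    (cubeOf : α → V) {dist : α → α → ℝ} (hdist : ∀ x₁ x₂, 0 ≤ dist x₁ x₂) {C Cloc : α → α → ℝ} {CX : Finset V → α → α → ℝ}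
    {c rek κ c' : ℝ} (hc : 0 ≤ c) (hrek : 0 ≤ rek) (hκ : 0 < κ) (h245 : Eq245 C Cloc CX)
    (h246 : Ineq246 (fun X : Finset V => X.card) (fun x X => cubeOf x ∈ X) CX c rek)
    (hconn : ∀ X x₁ x₂, CX X x₁ x₂ ≠ 0 → IsRConnected R X)
    (hdiam : ∀ X x₁ x₂, IsRConnected R X → cubeOf x₁ ∈ X → cubeOf x₂ ∈ X → dist x₁ x₂ ≤ κ * X.card)
    (hlarge : ((Δ : ℝ) + 1) ^ 2 * Real.exp (-(c / 2) * rek) ≤ 1 / 2) (hc'1 : c' ≤ c * rek / (2 * κ))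
    (hc'2 : 2 * Real.exp (-(c / 2) * rek) ≤ Real.exp (-c' * rek)) :
    Close dist Cloc C (Real.exp (-c' * rek)) c' := by
  intro x₁ x₂
  refine (close247_of_ineq246 hR hΔ hnbr cubeOf dist hc hrek hκ h245 h246 hconn hdiam hlarge x₁ x₂).trans ?_
  have hrate : Real.exp (-(c * rek / (2 * κ)) * dist x₁ x₂) ≤ Real.exp (-c' * dist x₁ x₂) :=
    Real.exp_le_exp.2 (by nlinarith [hdist x₁ x₂])
  exact mul_le_mul hc'2 hrate (Real.exp_nonneg _) (Real.exp_nonneg _)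

end Typed

/-! ## §5  Model instance of the geometry on `ℤ^d` (p36's `BIJ88WalkGeometryZd` cubes) -/

section Zd

open BIJ88WalkGeometryZd Literature.MathematicalPhysics.QuantumFieldTheory.Balaban1983to89.B4RandomWalk213

/-- **CUBE ARITHMETIC**: points of `ℤ` are within `ℓ·|cube index difference| + ℓ` of each other (side `ℓ ≥ 1`, cube index = Euclidean
quotient). [folklore] -/
private theorem natAbs_sub_le_of_cubeIdx {ℓ : ℕ} (hℓ : 0 < ℓ) (a b : ℤ) :
    ((a - b).natAbs : ℤ) ≤ ℓ * ((a / (ℓ : ℤ) - b / (ℓ : ℤ)).natAbs : ℤ) + ℓ := by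
  have hℓ' : (0 : ℤ) < ℓ := by exact_mod_cast hℓ
  have ha : (ℓ : ℤ) * (a / (ℓ : ℤ)) + a % (ℓ : ℤ) = a := Int.mul_ediv_add_emod a ℓ
  have hb : (ℓ : ℤ) * (b / (ℓ : ℤ)) + b % (ℓ : ℤ) = b := Int.mul_ediv_add_emod b ℓ
  have ha0 : 0 ≤ a % (ℓ : ℤ) := Int.emod_nonneg a hℓ'.ne'
  have hb0 : 0 ≤ b % (ℓ : ℤ) := Int.emod_nonneg b hℓ'.ne'
  have ha1 : a % (ℓ : ℤ) < ℓ := Int.emod_lt_of_pos a hℓ'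
  have hb1 : b % (ℓ : ℤ) < ℓ := Int.emod_lt_of_pos b hℓ'
  rw [Int.natCast_natAbs, Int.natCast_natAbs]
  have hsplit : a - b = (ℓ : ℤ) * (a / (ℓ : ℤ) - b / (ℓ : ℤ)) + (a % (ℓ : ℤ) - b % (ℓ : ℤ)) := by linear_combination -ha + hb
  have hr : |a % (ℓ : ℤ) - b % (ℓ : ℤ)| ≤ ℓ := abs_sub_le_iff.2 ⟨by linarith, by linarith⟩
  calc |a - b| = |(ℓ : ℤ) * (a / (ℓ : ℤ) - b / (ℓ : ℤ)) + (a % (ℓ : ℤ) - b % (ℓ : ℤ))| := by rw [hsplit]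
    _ ≤ |(ℓ : ℤ) * (a / (ℓ : ℤ) - b / (ℓ : ℤ))| + |a % (ℓ : ℤ) - b % (ℓ : ℤ)| := abs_add_le _ _
    _ ≤ (ℓ : ℤ) * |a / (ℓ : ℤ) - b / (ℓ : ℤ)| + ℓ := by rw [abs_mul, abs_of_pos hℓ']; linarith

variable {dd : ℕ}

/-- points of `ℤ^d` are within `ℓ·supDist(cube indices) + ℓ` in sup-distance (side `ℓ ≥ 1`): the hypothesis `hdom` of
`dist_le_of_isRConnected` for p36's cubes `BIJ88WalkGeometryZd.cubeIdx` (companion of p36's `sub_ge_of_cubeIdx`, the `r(e_k)`-cube arithmetic of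
(2.44)). [cite: BalabanImbrieJaffe1988, (2.44) p.264] -/
theorem supDist_le_of_cubeIdx {ℓ : ℕ} (hℓ : 0 < ℓ) (x y : Fin dd → ℤ) :
    supDist x y ≤ ℓ * supDist (cubeIdx ℓ x) (cubeIdx ℓ y) + ℓ := by
  set n : ℕ := Finset.univ.sup fun μ => (cubeIdx ℓ x μ - cubeIdx ℓ y μ).natAbs with hn
  have hq : supDist (cubeIdx ℓ x) (cubeIdx ℓ y) = (n : ℝ) := rfl
  have h1 : supDist x y ≤ ((ℓ * n + ℓ : ℕ) : ℝ) := by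
    rw [supDist_le_iff]
    intro μ
    have hμ : (cubeIdx ℓ x μ - cubeIdx ℓ y μ).natAbs ≤ n := Finset.le_sup (f := fun μ => (cubeIdx ℓ x μ - cubeIdx ℓ y μ).natAbs) (mem_univ μ)
    have h := natAbs_sub_le_of_cubeIdx hℓ (x μ) (y μ)
    have h' : ((x μ - y μ).natAbs : ℤ) ≤ ℓ * (n : ℤ) + ℓ := by
      have : (ℓ : ℤ) * ((x μ / (ℓ : ℤ) - y μ / (ℓ : ℤ)).natAbs : ℤ) ≤ ℓ * (n : ℤ) := by
        exact mul_le_mul_of_nonneg_left (by exact_mod_cast hμ) (by positivity)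
      exact h.trans (by linarith)
    exact_mod_cast h'
  rw [hq]
  exact_mod_cast h1

variable {ι : Type*} [Fintype ι]

/-- **(2.47) BY THE PRINTED ROUTE ON `ℤ^d`** («model instance» of the geometry): points = labels placed in `ℤ^d` by `pos` (p36's dictionary,
p. 264: the `M`-lattice), `r(e_k)`-cubes = p36's `BIJ88WalkGeometryZd.Cube pos ℓ` of side `ℓ` with `cubeOf`, connected = chains of TOUCHING cubes
(`B4RandomWalk213.cubeAdj` on the cube indices, degree `≤ 3^d` by `BIJ88WalkGeometryZd.card_touch_le`), distance = `supDist` of positions.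
Every geometric hypothesis of `close247_of_ineq246` is DISCHARGED (`κ = ℓ`: `dist_le_of_isRConnected` with the cube pseudo-distance
`ℓ·supDist` of indices, `supDist_le_one_of_cubeAdj`, `supDist_le_of_cubeIdx`); what remains is (2.45), (2.46) (`c, r(e_k) ≥ 0`), the
connectedness clause of (2.44), and «r(e_k) large» `(3^d + 1)²e^{−(c/2)r(e_k)} ≤ ½`:
`|C_loc(x₁,x₂) − C(x₁,x₂)| ≤ 2e^{−(c/2)r(e_k)} e^{−(c·r(e_k)/(2ℓ))·supDist(x₁,x₂)}`. [cite: BalabanImbrieJaffe1988, (2.47) p.265] -/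
theorem close247_of_ineq246_Zd (pos : ι → Fin dd → ℤ) {ℓ : ℕ} (hℓ : 0 < ℓ) {C Cloc : ι → ι → ℝ}
    {CX : Finset (Cube pos ℓ) → ι → ι → ℝ} {c rek : ℝ} (hc : 0 ≤ c) (hrek : 0 ≤ rek) (h245 : Eq245 C Cloc CX)
    (h246 : Ineq246 (fun X : Finset (Cube pos ℓ) => X.card) (fun i X => cubeOf pos ℓ i ∈ X) CX c rek)
    (hconn : ∀ X x₁ x₂, CX X x₁ x₂ ≠ 0 → IsRConnected (cubeAdj Subtype.val) X)
    (hlarge : ((3 ^ dd : ℕ) + 1 : ℝ) ^ 2 * Real.exp (-(c / 2) * rek) ≤ 1 / 2) (x₁ x₂ : ι) :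
    |Cloc x₁ x₂ - C x₁ x₂| ≤
      2 * Real.exp (-(c / 2) * rek) * Real.exp (-(c * rek / (2 * ℓ)) * supDist (pos x₁) (pos x₂)) := by
  classical
  have hℓr : (0 : ℝ) < ℓ := by exact_mod_cast hℓ
  refine close247_of_ineq246 (R := cubeAdj Subtype.val) (nbr := fun v => univ.filter fun w => cubeAdj Subtype.val v w)
    (Δ := 3 ^ dd) (fun v w h => touch_symm pos ℓ v w h) (fun v => card_touch_le pos ℓ v univ)
    (fun v w h => mem_filter.2 ⟨mem_univ _, h⟩) (cubeOf pos ℓ) (fun i l => supDist (pos i) (pos l)) hc hrek hℓr h245 h246 hconn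
    ?_ (by exact_mod_cast hlarge) x₁ x₂
  intro X y₁ y₂ hX h₁ h₂
  refine dist_le_of_isRConnected hX (fun v w : Cube pos ℓ => ℓ * supDist v.1 w.1) (fun v => by simp [supDist_self])
    (fun u v w => ?_) hℓr.le (fun v w h => ?_) (cubeOf pos ℓ) (fun i l => supDist (pos i) (pos l)) (fun i l => ?_) h₁ h₂
  · have := supDist_triangle u.1 v.1 w.1
    nlinarith
  · have h1 : supDist v.1 w.1 ≤ 1 := supDist_le_one_of_cubeAdj Subtype.val h
    have h2 : supDist w.1 v.1 ≤ 1 := by rw [supDist_comm]; exact h1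
    constructor <;> nlinarith
  · exact supDist_le_of_cubeIdx hℓ (pos i) (pos l)

end Zd

end

end Literature.MathematicalPhysics.QuantumFieldTheory.BalabanImbrieJaffe1984to88.BIJ88Close247Animals
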